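import Mathlib
import HarnessLib
import Summits.HubbardSuperconductivity.HubbardSuperconductivity.Theorems.KLProgrammeKLRegimeCountertermJacksonRemainderReadResidueC1Tables

/-!
# Route `KLProgramme`, crux K3 — gen-8 ENGINE-FLOW child (stmt-HubbardSuperconductivity-20437 `KLRegimeEngineV17F2`), stub (C)
# `stub_twoLeg_curvature`: the (C1) door's output FITTED to the `curveJetBar` currency of `readResidue_flow_hP` — explicit tables
# `eJ, eJ'` LINEAR in the induction hypothesis' private tables `cc, cc'`

Seat hubbard-kl-k3c3-p1 (g9; row «δμ-flow with klAngularMean constant piece»).  The cross-read of record (k3c3-p3 g11, KL STATUS 2026-08-27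
l.4135; pen (R79e) l.4112) fixes the `hJ` CURRENCY of the (C1) bracket `J(θ) = ν_n(K_n)(θ) − (klFlowPiece n).eval (k_F^{K_{n+1}} θ)` as EXACTLY the pair
`(hJdiff, hJ)` of `readResidue_flow_hP` (…FlowReadResidueSplit): `hJ : ∀ k ≤ 4, ∀ θ, |iteratedDeriv k J θ| ≤ curveJetBar eJ eJ' U k (n+1)` with tables
chosen by the SUPPLIER.  The one-call doors of this lineage (`readResidueC1_jets_of_twoLegReadJetBound(_klEng)`, p586985) deliver the certificate's
linear forms `T.bound â k` (rate rows `1 ≤ k ≤ 3`), `T.boundNR â k` (no-rate, `k ≤ 4`) and the value row `â₁·Td + â₀·N0` on the IH's size table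
`â l = curveJetBar cc cc' U l n` (`l ≥ 1`), `â 0 = (π/2)·curveJetBar cc cc' U 1 n`.  This file performs the fit ONCE, exactly (no slack except `|U| ≤ 1`
in the value row):

* §1 `CutoffDefectTable.bound_add/_smul`, `boundNR_add/_smul` — the linear forms ARE linear in the size table;
* §2 `ihTable_eq_natural` — `â l = U²·ĉ(cc) l + U²|U|·ĉ(cc') l` with the `U`-FREE natural table
  `ĉ(c) l := if l = 0 then (π/2)·c 1·4^{−n} else c l·4^{(l−2)n}` (written inline; no definition);
* §3 **`readResidueC1_curveJetBar_fit`** — from the four outputs of the one-call door and `|U| ≤ 1`, `cc' 1 ≥ 0`: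
  `∀ k ≤ 4, ∀ θ, |iteratedDeriv k J θ| ≤ curveJetBar eJ eJ' U k (n+1)` with the EXPLICIT tables
  `eJ k  = [k ≠ 0]·(rate/no-rate form of T on ĉ(cc)) · 4^{−(k−2)(n+1)}` (rate for `k ≤ 3`, no-rate at `k = 4`),
  `eJ' k = [k ≠ 0]·(same on ĉ(cc'))·4^{−(k−2)(n+1)} + [k = 0]·(cc 1 + cc' 1)(Td + (π/2)N0)·4^{−n}·16^{n+1}`
  — `eJ, eJ'` are LINEAR in `cc`, `cc'` (the share matrices of memo C1-HIST-C4 §3 are these maps evaluated on the record tables);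
* §4 **`readResidueC1_hJ_of_twoLegReadJetBound`** (explicit thresholds, abstract frame-size table `A`) and **`…_klEng`** (stub binders, `n + 1 ≤ 21`,
  frame sizes from `…ReadResidueC1Tables`):
  the LITERAL `(hJdiff, hJ)` pair of `readResidue_flow_hP` from the regime, `FrameOK … K_{n+1}`, the certificate `CutoffDefectCertFrame (klFlowDeg n) A T`
  and `hIH : TwoLegReadJetBound L M cc cc' β U μ K_n n`.

Bookkeeping only; no definitions; the certificate Prop stays a hypothesis; nothing here asserts superconductivity.
-/

noncomputable section

namespace Summit.HubbardSuperconductivity.HubbardSuperconductivity.Theorems.KLRegimeSplit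

set_option linter.dupNamespace false -- summit = problem name (single-conjunct summit), D-0017

open Real
open Literature.MathematicalPhysics.QuantumLattice Literature.Probability.LatticeModels
open Summit.HubbardSuperconductivity.HubbardSuperconductivity.Theorems.PerturbedFermiCurve
open Summit.HubbardSuperconductivity.HubbardSuperconductivity.Theorems.EngineV8

/-! ## §1 The certificate's linear forms are linear in the size table -/

/-- `T.bound` is additive in the size table. -/
theorem CutoffDefectTable.bound_add (T : CutoffDefectTable) (a b : ℕ → ℝ) (k : ℕ) :
    T.bound (fun l => a l + b l) k = T.bound a k + T.bound b k := by
  unfold CutoffDefectTable.bound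
  have h2 : ∑ i ∈ Finset.Ico 1 k, (k.choose i : ℝ) * ∑ l ∈ Finset.Icc 1 (k - i), (a l + b l) * T.Mc k i l =
      ∑ i ∈ Finset.Ico 1 k, (k.choose i : ℝ) * ∑ l ∈ Finset.Icc 1 (k - i), a l * T.Mc k i l +
        ∑ i ∈ Finset.Ico 1 k, (k.choose i : ℝ) * ∑ l ∈ Finset.Icc 1 (k - i), b l * T.Mc k i l := by
    rw [← Finset.sum_add_distrib]
    refine Finset.sum_congr rfl fun i _ => ?_
    rw [← mul_add, ← Finset.sum_add_distrib]
    congr 1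
    exact Finset.sum_congr rfl fun l _ => by ring
  have h3 : ∑ l ∈ Finset.Ico 1 k, (a l + b l) * T.Tt k l = ∑ l ∈ Finset.Ico 1 k, a l * T.Tt k l + ∑ l ∈ Finset.Ico 1 k, b l * T.Tt k l := by
    rw [← Finset.sum_add_distrib]
    exact Finset.sum_congr rfl fun l _ => by ring
  rw [h2, h3]
  split_ifs <;> ring

/-- `T.bound` is homogeneous in the size table. -/
theorem CutoffDefectTable.bound_smul (T : CutoffDefectTable) (s : ℝ) (a : ℕ → ℝ) (k : ℕ) :
    T.bound (fun l => s * a l) k = s * T.bound a k := by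
  unfold CutoffDefectTable.bound
  have h2 : ∑ i ∈ Finset.Ico 1 k, (k.choose i : ℝ) * ∑ l ∈ Finset.Icc 1 (k - i), s * a l * T.Mc k i l =
      s * ∑ i ∈ Finset.Ico 1 k, (k.choose i : ℝ) * ∑ l ∈ Finset.Icc 1 (k - i), a l * T.Mc k i l := by
    rw [Finset.mul_sum]
    refine Finset.sum_congr rfl fun i _ => ?_
    rw [Finset.mul_sum, Finset.mul_sum, Finset.mul_sum]
    exact Finset.sum_congr rfl fun l _ => by ring
  have h3 : ∑ l ∈ Finset.Ico 1 k, s * a l * T.Tt k l = s * ∑ l ∈ Finset.Ico 1 k, a l * T.Tt k l := by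
    rw [Finset.mul_sum]
    exact Finset.sum_congr rfl fun l _ => by ring
  rw [h2, h3]
  split_ifs <;> ring

/-- `T.boundNR` is additive in the size table. -/
theorem CutoffDefectTable.boundNR_add (T : CutoffDefectTable) (a b : ℕ → ℝ) (k : ℕ) :
    T.boundNR (fun l => a l + b l) k = T.boundNR a k + T.boundNR b k := by
  rw [T.boundNR_eq_bound_sub_add, T.boundNR_eq_bound_sub_add, T.boundNR_eq_bound_sub_add, T.bound_add]
  ring

/-- `T.boundNR` is homogeneous in the size table. -/
theorem CutoffDefectTable.boundNR_smul (T : CutoffDefectTable) (s : ℝ) (a : ℕ → ℝ) (k : ℕ) :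
    T.boundNR (fun l => s * a l) k = s * T.boundNR a k := by
  rw [T.boundNR_eq_bound_sub_add, T.boundNR_eq_bound_sub_add, T.bound_smul]
  ring

/-- The two-parameter linearity of `T.bound`. -/
theorem CutoffDefectTable.bound_lin (T : CutoffDefectTable) (s t : ℝ) (a b : ℕ → ℝ) (k : ℕ) :
    T.bound (fun l => s * a l + t * b l) k = s * T.bound a k + t * T.bound b k := by
  rw [show (fun l => s * a l + t * b l) = (fun l => (fun l => s * a l) l + (fun l => t * b l) l) from rfl, T.bound_add, T.bound_smul,
    T.bound_smul]

/-- The two-parameter linearity of `T.boundNR`. -/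
theorem CutoffDefectTable.boundNR_lin (T : CutoffDefectTable) (s t : ℝ) (a b : ℕ → ℝ) (k : ℕ) :
    T.boundNR (fun l => s * a l + t * b l) k = s * T.boundNR a k + t * T.boundNR b k := by
  rw [show (fun l => s * a l + t * b l) = (fun l => (fun l => s * a l) l + (fun l => t * b l) l) from rfl, T.boundNR_add, T.boundNR_smul,
    T.boundNR_smul]

/-! ## §2 The IH size table in natural (`U`-free) form -/

/-- **`â = U²·ĉ(cc) + U²|U|·ĉ(cc')`**: the one-call door's IH table factorises through the `U`-free natural tables. -/
theorem ihTable_eq_natural (cc cc' : ℕ → ℝ) (U : ℝ) (n : ℕ) :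
    (fun l : ℕ => if l = 0 then π / 2 * curveJetBar cc cc' U 1 n else curveJetBar cc cc' U l n) =
      fun l : ℕ => U ^ 2 * (if l = 0 then π / 2 * cc 1 * (4 : ℝ) ^ ((((1 : ℕ) : ℤ) - 2) * n) else cc l * (4 : ℝ) ^ (((l : ℤ) - 2) * n)) +
        U ^ 2 * |U| * (if l = 0 then π / 2 * cc' 1 * (4 : ℝ) ^ ((((1 : ℕ) : ℤ) - 2) * n) else cc' l * (4 : ℝ) ^ (((l : ℤ) - 2) * n)) := by
  funext l
  by_cases hl : l = 0
  · simp only [hl, if_true, curveJetBar, uPow, one_ne_zero, if_false]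
    ring
  · simp only [hl, if_false, curveJetBar, uPow]
    ring

/-! ## §3 The fit -/

section Fit

variable {L M : ℕ} [NeZero L] [NeZero M]

/-- `curveJetBar` at order `k` reads its tables only at `k`. -/
theorem curveJetBar_congr_at {c c' d d' : ℕ → ℝ} {U : ℝ} {k n : ℕ} (h : c k = d k) (h' : c' k = d' k) :
    curveJetBar c c' U k n = curveJetBar d d' U k n := by
  simp only [curveJetBar, h, h']

/-- Rescaling identity behind the fit (`k ≠ 0`): `(X·z⁻¹ + Y·z⁻¹·|U|)·U²·z = U²·X + U²|U|·Y` for `z = 4^{(k−2)(n+1)} ≠ 0`. -/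
theorem curveJetBar_rescale {k : ℕ} (hk : k ≠ 0) (X Y U : ℝ) (n : ℕ) :
    curveJetBar (fun _ => X * ((4 : ℝ) ^ (((k : ℤ) - 2) * ((n + 1 : ℕ) : ℤ)))⁻¹) (fun _ => Y * ((4 : ℝ) ^ (((k : ℤ) - 2) * ((n + 1 : ℕ) : ℤ)))⁻¹) U k
        (n + 1) = U ^ 2 * X + U ^ 2 * |U| * Y := by
  have hz : (4 : ℝ) ^ (((k : ℤ) - 2) * ((n + 1 : ℕ) : ℤ)) ≠ 0 := zpow_ne_zero _ (by norm_num)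
  simp only [curveJetBar, uPow, hk, if_false]
  field_simp

/-- **THE (C1) FIT.**  From the four outputs of the one-call door on the IH table (value row, rate rows `1 ≤ k ≤ 3`, no-rate rows `1 ≤ k ≤ 4`),
`|U| ≤ 1`, `0 ≤ cc' 1` and `0 ≤ T.Td + (π/2)·T.N0`: the (C1) bracket obeys `|∂ᵏJ| ≤ curveJetBar eJ eJ' U k (n+1)` for every `k ≤ 4` with the explicit
tables of the statement (rate form at `k ≤ 3`, no-rate at `k = 4`, value row at `k = 0`). -/
theorem readResidueC1_curveJetBar_fit {J : ℝ → ℝ} {T : CutoffDefectTable} {cc cc' : ℕ → ℝ} {U : ℝ} {n : ℕ} (hU1 : |U| ≤ 1)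
    (hcc'1 : 0 ≤ cc' 1) (hTd : 0 ≤ T.Td + π / 2 * T.N0)
    (h2 : ∀ θ : ℝ, |J θ| ≤ curveJetBar cc cc' U 1 n * T.Td + π / 2 * curveJetBar cc cc' U 1 n * T.N0)
    (h3 : ∀ k, 1 ≤ k → k ≤ 3 → ∀ θ : ℝ, |iteratedDeriv k J θ| ≤
      T.bound (fun l : ℕ => if l = 0 then π / 2 * curveJetBar cc cc' U 1 n else curveJetBar cc cc' U l n) k)
    (h4 : ∀ k, 1 ≤ k → k ≤ 4 → ∀ θ : ℝ, |iteratedDeriv k J θ| ≤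
      T.boundNR (fun l : ℕ => if l = 0 then π / 2 * curveJetBar cc cc' U 1 n else curveJetBar cc cc' U l n) k) :
    ∀ k ≤ 4, ∀ θ : ℝ, |iteratedDeriv k J θ| ≤
      curveJetBar
        (fun k => if k = 0 then 0 else
          (if k ≤ 3 then T.bound (fun l : ℕ => if l = 0 then π / 2 * cc 1 * (4 : ℝ) ^ ((((1 : ℕ) : ℤ) - 2) * n) else cc l * (4 : ℝ) ^ (((l : ℤ) - 2) * n)) k
            else T.boundNR (fun l : ℕ => if l = 0 then π / 2 * cc 1 * (4 : ℝ) ^ ((((1 : ℕ) : ℤ) - 2) * n) else cc l * (4 : ℝ) ^ (((l : ℤ) - 2) * n)) k) *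
            ((4 : ℝ) ^ (((k : ℤ) - 2) * ((n + 1 : ℕ) : ℤ)))⁻¹)
        (fun k => if k = 0 then (cc 1 + cc' 1) * (T.Td + π / 2 * T.N0) * (4 : ℝ) ^ ((((1 : ℕ) : ℤ) - 2) * n) *
            ((4 : ℝ) ^ ((((0 : ℕ) : ℤ) - 2) * ((n + 1 : ℕ) : ℤ)))⁻¹ else
          (if k ≤ 3 then T.bound (fun l : ℕ => if l = 0 then π / 2 * cc' 1 * (4 : ℝ) ^ ((((1 : ℕ) : ℤ) - 2) * n) else cc' l * (4 : ℝ) ^ (((l : ℤ) - 2) * n)) k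
            else T.boundNR (fun l : ℕ => if l = 0 then π / 2 * cc' 1 * (4 : ℝ) ^ ((((1 : ℕ) : ℤ) - 2) * n) else cc' l * (4 : ℝ) ^ (((l : ℤ) - 2) * n)) k) *
            ((4 : ℝ) ^ (((k : ℤ) - 2) * ((n + 1 : ℕ) : ℤ)))⁻¹)
        U k (n + 1) := by
  -- the natural tables
  set ĉ : ℕ → ℝ := fun l => if l = 0 then π / 2 * cc 1 * (4 : ℝ) ^ ((((1 : ℕ) : ℤ) - 2) * n) else cc l * (4 : ℝ) ^ (((l : ℤ) - 2) * n) with hĉ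
  set ĉ' : ℕ → ℝ := fun l => if l = 0 then π / 2 * cc' 1 * (4 : ℝ) ^ ((((1 : ℕ) : ℤ) - 2) * n) else cc' l * (4 : ℝ) ^ (((l : ℤ) - 2) * n) with hĉ'
  have hâ : (fun l : ℕ => if l = 0 then π / 2 * curveJetBar cc cc' U 1 n else curveJetBar cc cc' U l n) =
      fun l => U ^ 2 * ĉ l + U ^ 2 * |U| * ĉ' l := ihTable_eq_natural cc cc' U n
  intro k hk θ
  by_cases hk0 : k = 0
  · -- value row
    subst hk0
    rw [iteratedDeriv_zero]
    refine (h2 θ).trans ?_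
    have hz : (4 : ℝ) ^ ((((0 : ℕ) : ℤ) - 2) * ((n + 1 : ℕ) : ℤ)) ≠ 0 := zpow_ne_zero _ (by norm_num)
    simp only [curveJetBar, uPow, if_true, one_ne_zero, if_false, zero_add]
    rw [show (cc 1 + cc' 1) * (T.Td + π / 2 * T.N0) * (4 : ℝ) ^ ((((1 : ℕ) : ℤ) - 2) * n) *
        ((4 : ℝ) ^ ((((0 : ℕ) : ℤ) - 2) * ((n + 1 : ℕ) : ℤ)))⁻¹ * |U| * |U| * (4 : ℝ) ^ ((((0 : ℕ) : ℤ) - 2) * ((n + 1 : ℕ) : ℤ)) =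
        (cc 1 + cc' 1) * (|U| * |U|) * (4 : ℝ) ^ ((((1 : ℕ) : ℤ) - 2) * n) * (T.Td + π / 2 * T.N0) by field_simp]
    have hp : 0 ≤ (4 : ℝ) ^ ((((1 : ℕ) : ℤ) - 2) * n) := zpow_nonneg (by norm_num) _
    have hUU : U ^ 2 = |U| * |U| := by rw [← sq_abs, sq]
    rw [show (cc 1 + cc' 1 * |U|) * U ^ 2 * (4 : ℝ) ^ ((((1 : ℕ) : ℤ) - 2) * n) * T.Td +
        π / 2 * ((cc 1 + cc' 1 * |U|) * U ^ 2 * (4 : ℝ) ^ ((((1 : ℕ) : ℤ) - 2) * n)) * T.N0 =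
        (cc 1 + cc' 1 * |U|) * (|U| * |U|) * (4 : ℝ) ^ ((((1 : ℕ) : ℤ) - 2) * n) * (T.Td + π / 2 * T.N0) by rw [hUU]; ring]
    have hle : cc 1 + cc' 1 * |U| ≤ cc 1 + cc' 1 := by nlinarith [abs_nonneg U]
    have hnn : 0 ≤ |U| * |U| := mul_nonneg (abs_nonneg U) (abs_nonneg U)
    exact mul_le_mul_of_nonneg_right (mul_le_mul_of_nonneg_right (mul_le_mul_of_nonneg_right hle hnn) hp) hTd
  · have hk1 : 1 ≤ k := Nat.one_le_iff_ne_zero.mpr hk0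
    by_cases hk3 : k ≤ 3
    · have h := h3 k hk1 hk3 θ
      rw [hâ, T.bound_lin] at h
      refine h.trans (le_of_eq ?_)
      rw [← curveJetBar_rescale hk0 (T.bound ĉ k) (T.bound ĉ' k) U n]
      exact curveJetBar_congr_at (by simp [hk0, hk3]) (by simp [hk0, hk3])
    · have hk4 : k = 4 := by omega
      have h := h4 k hk1 (by omega) θ
      rw [hâ, T.boundNR_lin] at h
      refine h.trans (le_of_eq ?_)
      rw [← curveJetBar_rescale hk0 (T.boundNR ĉ k) (T.boundNR ĉ' k) U n]
      exact curveJetBar_congr_at (by simp [hk0, hk3]) (by simp [hk0, hk3])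

end Fit

/-! ## §4 The `(hJdiff, hJ)` pair of `readResidue_flow_hP`, one call -/

section Door

variable {L M : ℕ} [NeZero L] [NeZero M]

/-- `T.Td + (π/2)·T.N0 ≥ 0` for a certificate table whose `Td`, `N0` are nonnegative — recorded for the records (all entries are nonnegative literals). -/
theorem CutoffDefectTable.td_add_n0_nonneg {T : CutoffDefectTable} (hTd : 0 ≤ T.Td) (hN0 : 0 ≤ T.N0) : 0 ≤ T.Td + π / 2 * T.N0 := by
  positivity

/-- **THE (C1) DOOR IN `readResidue_flow_hP`'S CURRENCY** (explicit thresholds `klCurveC3/klCurveU0`, abstract frame-size table `A`): from the regime,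
`FrameOK … K_{n+1}`, the certificate `CutoffDefectCertFrame (klFlowDeg n) A T` (`Td, N0 ≥ 0`), frame sizes `≤ A`, and the IH
`TwoLegReadJetBound L M cc cc' β U μ K_n n` (`cc, cc' ≥ 0`): `J ∈ C⁴` and `∀ k ≤ 4, |∂ᵏJ θ| ≤ curveJetBar eJ eJ' U k (n+1)` with the explicit tables of
`readResidueC1_curveJetBar_fit`. -/
theorem readResidueC1_hJ_of_twoLegReadJetBound {R : RenConsts} (hR : ∀ j, 0 ≤ R.Gfr j) {c : ℝ} (hc : 0 < c) (hcle : c ≤ klCurveC3 R)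
    {U : ℝ} (hU : 0 < U) (hUle : U ≤ klCurveU0 R) {β : ℝ} (hβmin : klBetaMin ≤ β) (hβc : β ≤ Real.exp (c / U ^ 2))
    {μ : ℝ} (hμ : μ ∈ klWindowC) {n : ℕ} (hK : FrameOK R U (nScales β) μ (klFlowFrameU L M β U μ (n + 1)))
    {d : ℕ} (hd : klFlowDeg n = d) {A : ℕ → ℝ} {T : CutoffDefectTable} (hcert : CutoffDefectCertFrame d A T) (hTd : 0 ≤ T.Td) (hN0 : 0 ≤ T.N0)
    (hA : ∀ j ≤ 4, ∀ p : EuclideanSpace ℝ (Fin 2),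
      ‖iteratedFDeriv ℝ j (fun q : EuclideanSpace ℝ (Fin 2) => (klFlowFrameU L M β U μ (n + 1)).eval (WithLp.ofLp q)) p‖ ≤ A j)
    {cc cc' : ℕ → ℝ} (hcc : ∀ k, 0 ≤ cc k) (hcc' : ∀ k, 0 ≤ cc' k)
    (hIH : TwoLegReadJetBound L M cc cc' β U μ (klFlowFrameU L M β U μ n) n) :
    ContDiff ℝ 4 (fun θ : ℝ => klLocalPart L M β U μ (klFlowFrameU L M β U μ n) n θ -
        (klFlowPiece L M β U μ n).eval (klFermiPoint μ (klFlowFrameU L M β U μ (n + 1)) θ)) ∧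
    ∀ k ≤ 4, ∀ θ : ℝ, |iteratedDeriv k (fun θ : ℝ => klLocalPart L M β U μ (klFlowFrameU L M β U μ n) n θ -
        (klFlowPiece L M β U μ n).eval (klFermiPoint μ (klFlowFrameU L M β U μ (n + 1)) θ)) θ| ≤
      curveJetBar
        (fun k => if k = 0 then 0 else
          (if k ≤ 3 then T.bound (fun l : ℕ => if l = 0 then π / 2 * cc 1 * (4 : ℝ) ^ ((((1 : ℕ) : ℤ) - 2) * n) else cc l * (4 : ℝ) ^ (((l : ℤ) - 2) * n)) k
            else T.boundNR (fun l : ℕ => if l = 0 then π / 2 * cc 1 * (4 : ℝ) ^ ((((1 : ℕ) : ℤ) - 2) * n) else cc l * (4 : ℝ) ^ (((l : ℤ) - 2) * n)) k) *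
            ((4 : ℝ) ^ (((k : ℤ) - 2) * ((n + 1 : ℕ) : ℤ)))⁻¹)
        (fun k => if k = 0 then (cc 1 + cc' 1) * (T.Td + π / 2 * T.N0) * (4 : ℝ) ^ ((((1 : ℕ) : ℤ) - 2) * n) *
            ((4 : ℝ) ^ ((((0 : ℕ) : ℤ) - 2) * ((n + 1 : ℕ) : ℤ)))⁻¹ else
          (if k ≤ 3 then T.bound (fun l : ℕ => if l = 0 then π / 2 * cc' 1 * (4 : ℝ) ^ ((((1 : ℕ) : ℤ) - 2) * n) else cc' l * (4 : ℝ) ^ (((l : ℤ) - 2) * n)) k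
            else T.boundNR (fun l : ℕ => if l = 0 then π / 2 * cc' 1 * (4 : ℝ) ^ ((((1 : ℕ) : ℤ) - 2) * n) else cc' l * (4 : ℝ) ^ (((l : ℤ) - 2) * n)) k) *
            ((4 : ℝ) ^ (((k : ℤ) - 2) * ((n + 1 : ℕ) : ℤ)))⁻¹)
        U k (n + 1) := by
  obtain ⟨h1, h2, h3, h4⟩ := readResidueC1_jets_of_twoLegReadJetBound hR hc hcle hU hUle hβmin hβc hμ hK hd hcert hA hcc hcc' hIH
  have hU1 : |U| ≤ 1 := by rw [abs_of_pos hU]; exact hUle.trans (klCurveU0_le_one R)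
  exact ⟨h1, readResidueC1_curveJetBar_fit hU1 (hcc' 1) (CutoffDefectTable.td_add_n0_nonneg hTd hN0) h2 h3 h4⟩

/-- **THE SAME AT STUB (C)'s BINDERS** (`R.WF`, `c ≤ klEngC₃6 P R`, `U ≤ klEngU₀9 P R c`, reading scale `n + 1 ≤ 21` — the whole table branch
`n + 1 ≤ 5` and beyond —, history `FlowPieceJetsAt … m` for `m ≤ n`, any certificate size table `A ≥ 10⁻¹²`: all six records). -/
theorem readResidueC1_hJ_of_twoLegReadJetBound_klEng {P : SplitConsts} {R : RenConsts} (hRW : R.WF) {c : ℝ} (hc : 0 < c)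
    (hc6 : c ≤ klEngC₃6 P R) {μ : ℝ} (hμ : μ ∈ klWindowC) {U : ℝ} (hU : 0 < U) (hU9 : U ≤ klEngU₀9 P R c) {β : ℝ}
    (hβmin : klBetaMin ≤ β) (hβc : β ≤ Real.exp (c / U ^ 2)) {n : ℕ} (hn : n + 1 ≤ 21)
    (hK : FrameOK R U (nScales β) μ (klFlowFrameU L M β U μ (n + 1))) (hist : ∀ m < n + 1, FlowPieceJetsAt L M β U μ R m)
    {d : ℕ} (hd : klFlowDeg n = d) {A : ℕ → ℝ} {T : CutoffDefectTable} (hcert : CutoffDefectCertFrame d A T) (hTd : 0 ≤ T.Td) (hN0 : 0 ≤ T.N0)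
    (hA12 : ∀ j ≤ 4, (1 : ℝ) / 10 ^ 12 ≤ A j)
    {cc cc' : ℕ → ℝ} (hcc : ∀ k, 0 ≤ cc k) (hcc' : ∀ k, 0 ≤ cc' k)
    (hIH : TwoLegReadJetBound L M cc cc' β U μ (klFlowFrameU L M β U μ n) n) :
    ContDiff ℝ 4 (fun θ : ℝ => klLocalPart L M β U μ (klFlowFrameU L M β U μ n) n θ -
        (klFlowPiece L M β U μ n).eval (klFermiPoint μ (klFlowFrameU L M β U μ (n + 1)) θ)) ∧
    ∀ k ≤ 4, ∀ θ : ℝ, |iteratedDeriv k (fun θ : ℝ => klLocalPart L M β U μ (klFlowFrameU L M β U μ n) n θ -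
        (klFlowPiece L M β U μ n).eval (klFermiPoint μ (klFlowFrameU L M β U μ (n + 1)) θ)) θ| ≤
      curveJetBar
        (fun k => if k = 0 then 0 else
          (if k ≤ 3 then T.bound (fun l : ℕ => if l = 0 then π / 2 * cc 1 * (4 : ℝ) ^ ((((1 : ℕ) : ℤ) - 2) * n) else cc l * (4 : ℝ) ^ (((l : ℤ) - 2) * n)) k
            else T.boundNR (fun l : ℕ => if l = 0 then π / 2 * cc 1 * (4 : ℝ) ^ ((((1 : ℕ) : ℤ) - 2) * n) else cc l * (4 : ℝ) ^ (((l : ℤ) - 2) * n)) k) *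
            ((4 : ℝ) ^ (((k : ℤ) - 2) * ((n + 1 : ℕ) : ℤ)))⁻¹)
        (fun k => if k = 0 then (cc 1 + cc' 1) * (T.Td + π / 2 * T.N0) * (4 : ℝ) ^ ((((1 : ℕ) : ℤ) - 2) * n) *
            ((4 : ℝ) ^ ((((0 : ℕ) : ℤ) - 2) * ((n + 1 : ℕ) : ℤ)))⁻¹ else
          (if k ≤ 3 then T.bound (fun l : ℕ => if l = 0 then π / 2 * cc' 1 * (4 : ℝ) ^ ((((1 : ℕ) : ℤ) - 2) * n) else cc' l * (4 : ℝ) ^ (((l : ℤ) - 2) * n)) k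
            else T.boundNR (fun l : ℕ => if l = 0 then π / 2 * cc' 1 * (4 : ℝ) ^ ((((1 : ℕ) : ℤ) - 2) * n) else cc' l * (4 : ℝ) ^ (((l : ℤ) - 2) * n)) k) *
            ((4 : ℝ) ^ (((k : ℤ) - 2) * ((n + 1 : ℕ) : ℤ)))⁻¹)
        U k (n + 1) := by
  have hR : ∀ j, 0 ≤ R.Gfr j := hRW.2.2
  have hcle : c ≤ klCurveC3 R := hc6.trans ((klEngC₃6_le_klEngC₃3 P R).trans (klEngC₃3_le_klCurveC3 P hR))
  have hUle : U ≤ klCurveU0 R := hU9.trans ((klEngU₀9_le_klEngU₀3 P R c).trans (klEngU₀3_le_klCurveU0 P hR c))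
  have hA := flowFrame_sizes_le_table_of_klEngU₀9_of_le (L := L) (M := M) (β := β) (μ := μ) hRW hU hU9 hn hist hA12
  exact readResidueC1_hJ_of_twoLegReadJetBound hR hc hcle hU hUle hβmin hβc hμ hK hd hcert hTd hN0 hA hcc hcc' hIH

end Door

end Summit.HubbardSuperconductivity.HubbardSuperconductivity.Theorems.KLRegimeSplit

end
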